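import Summits.QuantumFields.BalabanUV.Beta.GAN24.FibreDFT
import Summits.QuantumFields.BalabanUV.Beta.ModeSum

/-!
# Beta / AliasCharacters — the RESTRICTED ALIAS CHARACTERS of one block as matrices: `E_t : (box × Fin D) × Fin D`,
# `F_t : Fin D × (box × Fin D)`, their BIORTHOGONALITY `F_t E_s = δ_ts·1` (= `Beta/ModeSum.Biorth`) and COMPLETENESS `Σ_t E_t F_t = 1`,
# from the box-character orthogonality of `GAN24/FibreDFT` BY NAME
# (β sub-cell, CAP lane «KERNEL ALGEBRA + EXPORT», lineage `b2b-balaban-beta-cap3`, gen 10; instance fact I1 for `Beta/ModeSum`)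

WHY.  `Beta/ModeSum` states its mode-sum algebra (`modeSum`, `Biorth.groupInverse`, `Biorth.one_sub_modeSum_mul`, …) over an ABSTRACT
biorthogonal family `E_t`, `F_t` with `F_t E_s = δ_ts·1` and, where needed, `Σ_t E_t F_t = 1`.  In the cell's instance (CAP-KERNEL §4.15–§4.17)
the family is the fine-Parseval one: on the block `(ℤ/N)^D` (for Bałaban's step `N = 3`, `D = 4`: 81 sites, 324 bonds) the alias mode
`t ∈ (ℤ/N)^D` has the character `x ↦ e^{2πi t·x/N}` = `FibreDFT.boxChar t x`, tensored with the identity on the direction index.  This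
leaf packages exactly that: `charE t (x, μ) ν = δ_{μν}·boxChar t x`, `charF t ν (x, μ) = δ_{μν}·boxChar (−t) x / N^D`, and proves
`Biorth charE charF` and `Σ_t charE t * charF t = 1` from `FibreDFT.sum_boxChar'` ∕ `sum_boxChar` — [folklore] finite Fourier
bookkeeping, nothing of `FibreDFT` re-proved.  The quasi-momentum twist `e^{i q·x/N}` of the true alias plane waves (`FibreDFT.pw_kFine`)
is an invertible diagonal multiplier on the bond index and is absorbed by `ModeSum.Biorth.similar`; it is not repeated here.

## What is proved (`D N : ℕ`, `[NeZero N]`; `box = TorusSite D N = Fin D → ZMod N`)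
* §1 character algebra in the MODE argument: `boxChar_zero_left`, `boxChar_add_left`, `boxChar_neg_left_mul_self`,
  `sum_boxChar_neg_mul : Σ_x boxChar (−t) x · boxChar s x = [t = s]·N^D`, `sum_boxChar_mul_neg : Σ_t boxChar t x · boxChar (−t) y = [x = y]·N^D`
  (`N^D ≠ 0` is `GAN24.FibreDFT.pow_card_ne_zero`, by name).
* §2 `charE`, `charF` (defs), `charF_mul_charE_apply`, `charF_mul_charE : charF t * charE s = if t = s then 1 else 0`,
  `biorth_char : ModeSum.Biorth charE charF`, `sum_charE_mul_charF_apply`, `sum_charE_mul_charF : Σ_t charE t * charF t = 1`.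

HONEST FRAMING.  Finite Fourier bookkeeping, [folklore]; no estimate, no cited fact, no number beyond `N^D`.  This module proves NO bound on any
object of the cell, NO number of the β-function, NO statement about Bałaban's operators and discharges NOTHING of `FlowStep.BetaPertH`; it is not
an engine and not the concrete instance file.  Discharging `BetaPertH` would make Bałaban's ultraviolet stability unconditional — NOT the
continuum limit and NOT the Clay problem.  0 `sorry`, 0 cite tags; imports `Beta/GAN24/FibreDFT` and `Beta/ModeSum` only.
-/

namespace Summit.QuantumFields.BalabanUV.Beta.AliasCharacters

open Matrix Finset
open Literature.Probability.LatticeModels (TorusSite)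
open GAN24.FibreDFT (boxChar boxChar_comm sum_boxChar sum_boxChar' pow_card_ne_zero)
open ModeSum (Biorth)

variable {D N : ℕ} [NeZero N]

/-! ## §1 Character algebra in the mode argument -/

/-- [folklore] `boxChar 0 z = 1`. -/
theorem boxChar_zero_left (z : TorusSite D N) : boxChar (0 : TorusSite D N) z = 1 := by
  unfold boxChar
  simp

/-- [folklore] Additivity in the mode: `boxChar (m + m') z = boxChar m z · boxChar m' z`. -/
theorem boxChar_add_left (m m' z : TorusSite D N) : boxChar (m + m') z = boxChar m z * boxChar m' z := by
  unfold boxChar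
  rw [← prod_mul_distrib]
  refine prod_congr rfl fun μ _ => ?_
  rw [Pi.add_apply, add_mul, AddChar.map_add_eq_mul]

/-- [folklore] `boxChar (−m) z · boxChar m z = 1`. -/
theorem boxChar_neg_left_mul_self (m z : TorusSite D N) : boxChar (-m) z * boxChar m z = 1 := by
  rw [← boxChar_add_left, neg_add_cancel, boxChar_zero_left]

/-- [folklore] ORTHOGONALITY in the form used for biorthogonality: `Σ_x boxChar (−t) x · boxChar s x = [t = s]·N^D`. -/
theorem sum_boxChar_neg_mul (t s : TorusSite D N) :
    ∑ x : TorusSite D N, boxChar (-t) x * boxChar s x = if t = s then (N : ℂ) ^ D else 0 := by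
  have h : ∀ x : TorusSite D N, boxChar (-t) x * boxChar s x = boxChar (s - t) x := fun x => by
    rw [sub_eq_add_neg, boxChar_add_left, mul_comm]
  simp_rw [h, sum_boxChar' (s - t), sub_eq_zero, eq_comm]

/-- [folklore] COMPLETENESS form: `Σ_t boxChar t x · boxChar (−t) y = [x = y]·N^D`. -/
theorem sum_boxChar_mul_neg (x y : TorusSite D N) :
    ∑ t : TorusSite D N, boxChar t x * boxChar (-t) y = if x = y then (N : ℂ) ^ D else 0 := by
  have h : ∀ t : TorusSite D N, boxChar t x * boxChar (-t) y = boxChar t (x - y) := fun t => by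
    rw [boxChar_comm t x, boxChar_comm (-t) y, boxChar_comm t (x - y), sub_eq_add_neg, boxChar_add_left]
    congr 1
    unfold boxChar
    refine prod_congr rfl fun μ _ => ?_
    simp [mul_comm]
  simp_rw [h, sum_boxChar (x - y), sub_eq_zero]

/-! ## §2 The restricted characters as matrices; biorthogonality and completeness -/

/-- The mode-`t` character on the bonds of the block, tensored with the identity on directions:
`charE t (x, μ) ν = δ_{μν} · boxChar t x`. -/
noncomputable def charE (t : TorusSite D N) : Matrix (TorusSite D N × Fin D) (Fin D) ℂ :=
  Matrix.of fun xμ ν => if xμ.2 = ν then boxChar t xμ.1 else 0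

/-- The dual character with the Parseval constant absorbed: `charF t ν (x, μ) = δ_{μν} · boxChar (−t) x / N^D`. -/
noncomputable def charF (t : TorusSite D N) : Matrix (Fin D) (TorusSite D N × Fin D) ℂ :=
  Matrix.of fun ν xμ => if xμ.2 = ν then boxChar (-t) xμ.1 / (N : ℂ) ^ D else 0

/-- [folklore] Entries of `charE`. -/
theorem charE_apply (t : TorusSite D N) (x : TorusSite D N) (μ ν : Fin D) :
    charE t (x, μ) ν = if μ = ν then boxChar t x else 0 := rfl

/-- [folklore] Entries of `charF`. -/
theorem charF_apply (t : TorusSite D N) (ν : Fin D) (x : TorusSite D N) (μ : Fin D) :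
    charF t ν (x, μ) = if μ = ν then boxChar (-t) x / (N : ℂ) ^ D else 0 := rfl

/-- [folklore] Entries of `charF t * charE s`: `[t = s ∧ ν = ν']`. -/
theorem charF_mul_charE_apply (t s : TorusSite D N) (ν ν' : Fin D) :
    (charF t * charE s) ν ν' = if t = s ∧ ν = ν' then 1 else 0 := by
  rw [Matrix.mul_apply, Fintype.sum_prod_type]
  have hx : ∀ x : TorusSite D N, ∑ μ : Fin D, charF t ν (x, μ) * charE s (x, μ) ν'
      = if ν = ν' then boxChar (-t) x * boxChar s x / (N : ℂ) ^ D else 0 := fun x => by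
    rw [Finset.sum_eq_single ν]
    · rw [charF_apply, charE_apply, if_pos rfl]
      by_cases h : ν = ν'
      · rw [if_pos h, if_pos h, div_mul_eq_mul_div]
      · rw [if_neg h, if_neg h, mul_zero]
    · intro μ _ hμ
      rw [charF_apply, if_neg hμ, zero_mul]
    · intro h
      exact absurd (Finset.mem_univ ν) h
  simp_rw [hx]
  by_cases hν : ν = ν'
  · simp_rw [if_pos hν, ← Finset.sum_div, sum_boxChar_neg_mul]
    by_cases hts : t = s
    · rw [if_pos hts, if_pos ⟨hts, hν⟩, div_self pow_card_ne_zero]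
    · rw [if_neg hts, zero_div, if_neg fun hh => hts hh.1]
  · simp_rw [if_neg hν, Finset.sum_const_zero]
    rw [if_neg fun hh => hν hh.2]

/-- [folklore] BIORTHOGONALITY: `charF t * charE s = [t = s]·1` (fine Parseval with the constant `N^D` absorbed into `charF`). -/
theorem charF_mul_charE (t s : TorusSite D N) : charF t * charE s = if t = s then 1 else 0 := by
  ext ν ν'
  rw [charF_mul_charE_apply]
  by_cases hts : t = s
  · rw [if_pos hts, Matrix.one_apply]
    by_cases hν : ν = ν'
    · rw [if_pos ⟨hts, hν⟩, if_pos hν]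
    · rw [if_neg fun hh => hν hh.2, if_neg hν]
  · rw [if_neg hts, Matrix.zero_apply, if_neg fun hh => hts hh.1]

/-- [folklore] The restricted alias characters form a `ModeSum.Biorth` family. -/
theorem biorth_char : Biorth (charE (D := D) (N := N)) charF := fun t s => charF_mul_charE t s

/-- [folklore] Entries of `Σ_t charE t * charF t`: `[x = y ∧ μ = μ']`. -/
theorem sum_charE_mul_charF_apply (x y : TorusSite D N) (μ μ' : Fin D) :
    (∑ t : TorusSite D N, charE t * charF t) (x, μ) (y, μ') = if x = y ∧ μ = μ' then 1 else 0 := by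
  rw [Matrix.sum_apply]
  simp_rw [Matrix.mul_apply]
  have ht : ∀ t : TorusSite D N, ∑ ν : Fin D, charE t (x, μ) ν * charF t ν (y, μ')
      = if μ = μ' then boxChar t x * boxChar (-t) y / (N : ℂ) ^ D else 0 := fun t => by
    rw [Finset.sum_eq_single μ]
    · rw [charE_apply, charF_apply, if_pos rfl]
      by_cases h : μ = μ'
      · rw [if_pos h.symm, if_pos h, mul_div_assoc]
      · rw [if_neg (Ne.symm h), if_neg h, mul_zero]
    · intro ν _ hν
      rw [charE_apply, if_neg (Ne.symm hν), zero_mul]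
    · intro h
      exact absurd (Finset.mem_univ μ) h
  simp_rw [ht]
  by_cases h : μ = μ'
  · simp_rw [if_pos h, ← Finset.sum_div, sum_boxChar_mul_neg]
    by_cases hxy : x = y
    · rw [if_pos hxy, if_pos ⟨hxy, h⟩, div_self pow_card_ne_zero]
    · rw [if_neg hxy, zero_div, if_neg fun hh => hxy hh.1]
  · simp_rw [if_neg h, Finset.sum_const_zero]
    rw [if_neg fun hh => h hh.2]

/-- [folklore] COMPLETENESS: `Σ_t charE t * charF t = 1` on the bond space of the block. -/
theorem sum_charE_mul_charF : ∑ t : TorusSite D N, charE t * charF t = 1 := by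
  ext xμ yμ'
  obtain ⟨x, μ⟩ := xμ
  obtain ⟨y, μ'⟩ := yμ'
  rw [sum_charE_mul_charF_apply, Matrix.one_apply]
  simp only [Prod.mk.injEq]

end Summit.QuantumFields.BalabanUV.Beta.AliasCharacters
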